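/-
COR-CM (cell pub-hodgecm2, stage 2 of the Hodge ladder) — count-neutral KERNEL COMBINATORICS «quartic Aut-data from a central element of order four and a complement»
(seat prover-pub-hodgecm2-b23-g41-0, binder prover b23, gen 41; claim QUARTIC-TRANSPORT, blanket `CorCM/FaceQuarticTwist*` HOME/INBOX.md l.10129).
Theorems only (group theory, Mathlib); no geometry, no named fact, nothing asserted; `Interfaces.lean` (C1), every E term, B01, `Transposition/*`, `PortJoin/*` untouched.
HONEST FRAMING: `HC_CM` is NOT proved, here or anywhere in the tree; nothing here is a period, a count of record or a headline.
T5: n/a-class (hypothesis binders: order / centrality / complement conditions on a finite group); checker: self, 2026-08-23.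
-/
import Mathlib

/-!
# Quartic `Aut`-data from group structure: a central `u` of order `4` with `u² = c` and a complement `K` of `⟨u⟩`

The field-form law of the quartic twist (`CorCM/FaceQuarticTwistGeneration.lean`, `isLeast_card_faces_hgen_of_quartic_aut`) takes an `Aut`-datum
`ε : Aut(F) ≃ ℤ/4 × B`, multiplicative-to-additive, with `ε (conj) = (2, 0)`.  For `F = k₄·L` (`k₄` cyclic quartic CM, `L` totally real Galois, linearly
disjoint) the natural data are GROUP-THEORETIC: `u` = a generator of `Gal(F/L) ≅ ℤ/4` (central, `u² =` complex conjugation) and `K = Gal(F/k₄) ≅ Gal(L/ℚ)`,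
with `⟨u⟩ ∩ K = 1` and `|Aut F| = 4·|K|`.  This file turns such data, in ANY finite group `A`, into the datum:

* `exists_quarticDatum_of_central` : `orderOf u = 4`, `u` central, `K ≤ A` with `zpowers u ⊓ K = ⊥` and `|A| = 4|K|` ⟹
  `∃ ε : A ≃ ZMod 4 × Additive K`, `ε (g h) = ε g + ε h`, `ε (u ^ 2) = (2, 0)` (and `ε u = (1, 0)`, `ε k = (0, k)` for `k ∈ K`).

The screw condition of seat b09's law reads `∃ t : Additive K, 4 ∣ addOrderOf t ↔ ∃ k ∈ K, 4 ∣ orderOf k` (`exists_four_dvd_addOrderOf_iff`).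

## References
* (group theory, folklore) internal direct products.
-/

namespace Summit.HodgeConjecture.CorCM.FaceQuarticTwist

variable {A : Type*} [Group A]

/-- Powers of an element of order `4` depend on the exponent mod `4`: `u ^ (k.val)` is additive in `k : ZMod 4`. [folklore] -/
theorem pow_val_add (u : A) (hu : orderOf u = 4) (k k' : ZMod 4) : u ^ (k + k').val = u ^ k.val * u ^ k'.val := by
  rw [← pow_add, pow_eq_pow_iff_modEq, hu, ZMod.val_add]
  exact Nat.mod_modEq _ _

/-- **The quartic datum from a central element of order four and a complement.**  `A` a finite group, `u ∈ A` central of order `4`, `K ≤ A` with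
`⟨u⟩ ∩ K = 1` and `|A| = 4·|K|`: there is a bijection `ε : A ≃ ℤ/4 × K` (with `K` written additively), multiplicative-to-additive, with `ε u = (1, 0)`,
`ε k = (0, k)` on `K`, hence `ε (u²) = (2, 0)`. [folklore] -/
theorem exists_quarticDatum_of_central [Fintype A] [DecidableEq A] (u : A) (hu : orderOf u = 4) (hcen : ∀ g : A, g * u = u * g)
    (K : Subgroup A) [DecidablePred (· ∈ K)] (hint : ∀ n : ℕ, u ^ n ∈ K → u ^ n = 1) (hcard : Fintype.card A = 4 * Fintype.card K) :
    ∃ ε : A ≃ ZMod 4 × Additive K, (∀ g h : A, ε (g * h) = ε g + ε h) ∧ ε u = (1, 0) ∧ (∀ k : K, ε k = (0, Additive.ofMul k)) ∧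
      ε (u ^ 2) = (2, 0) := by
  -- the candidate inverse
  let φ : ZMod 4 × Additive K → A := fun p => u ^ p.1.val * ((Additive.toMul p.2 : K) : A)
  have hφmul : ∀ p q, φ (p + q) = φ p * φ q := by
    intro p q
    show u ^ (p.1 + q.1).val * (((Additive.toMul (p.2 + q.2) : K)) : A) = u ^ p.1.val * ((Additive.toMul p.2 : K) : A) * (u ^ q.1.val * ((Additive.toMul q.2 : K) : A))
    rw [pow_val_add u hu, toMul_add, Subgroup.coe_mul]
    -- u^a u^b (k k') = u^a k u^b k'  using centrality of powers of u
    have hcenpow : ∀ (n : ℕ) (g : A), g * u ^ n = u ^ n * g := fun n g => by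
      induction n with
      | zero => simp
      | succ n ih => rw [pow_succ, ← mul_assoc, ih, mul_assoc, hcen, ← mul_assoc]
    rw [mul_assoc, mul_assoc, ← mul_assoc (((Additive.toMul p.2 : K)) : A), hcenpow, mul_assoc]
  have hφinj : Function.Injective φ := by
    rintro ⟨a, k⟩ ⟨b, k'⟩ hpq
    simp only [φ] at hpq
    have hu4 : u ^ 4 = 1 := by rw [← hu]; exact pow_orderOf_eq_one u
    -- (u^b)⁻¹ u^a = k' k⁻¹, and (u^b)⁻¹ = u^{3b}
    have h1 : (u ^ b.val)⁻¹ * u ^ a.val = ((Additive.toMul k' : K) : A) * (((Additive.toMul k : K) : A))⁻¹ := by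
      calc (u ^ b.val)⁻¹ * u ^ a.val = (u ^ b.val)⁻¹ * (u ^ a.val * ((Additive.toMul k : K) : A)) * (((Additive.toMul k : K) : A))⁻¹ := by group
        _ = (u ^ b.val)⁻¹ * (u ^ b.val * ((Additive.toMul k' : K) : A)) * (((Additive.toMul k : K) : A))⁻¹ := by rw [hpq]
        _ = ((Additive.toMul k' : K) : A) * (((Additive.toMul k : K) : A))⁻¹ := by group
    have hinv : (u ^ b.val)⁻¹ = u ^ (3 * b.val) := by
      rw [inv_eq_iff_mul_eq_one, ← pow_add, show b.val + 3 * b.val = 4 * b.val by ring, pow_mul, hu4, one_pow]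
    rw [hinv, ← pow_add] at h1
    have hmem : u ^ (3 * b.val + a.val) ∈ K := by
      rw [h1]; exact K.mul_mem (Additive.toMul k').2 (K.inv_mem (Additive.toMul k).2)
    have hone := hint _ hmem
    rw [hone] at h1
    -- so k' = k
    have hkk : ((Additive.toMul k' : K) : A) = ((Additive.toMul k : K) : A) := (mul_inv_eq_one.mp h1.symm)
    have hk : k = k' := Additive.toMul.injective (Subtype.ext hkk.symm)
    -- and u^a = u^b
    have hab : u ^ a.val = u ^ b.val := by
      rw [← hkk] at hpq
      exact mul_right_cancel hpq
    rw [pow_eq_pow_iff_modEq, hu] at hab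
    have hab' : a = b := by
      have h := (ZMod.natCast_eq_natCast_iff' a.val b.val 4).mpr hab
      simpa [ZMod.natCast_zmod_val] using h
    rw [hab', hk]
  have hφbij : Function.Bijective φ := by
    rw [Fintype.bijective_iff_injective_and_card]
    refine ⟨hφinj, ?_⟩
    rw [Fintype.card_prod, ZMod.card, hcard, Fintype.card_congr Additive.toMul]
  let e := Equiv.ofBijective φ hφbij
  refine ⟨e.symm, fun g h => ?_, ?_, fun k => ?_, ?_⟩
  · apply e.injective
    rw [Equiv.apply_symm_apply]
    show g * h = φ (e.symm g + e.symm h)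
    rw [hφmul]
    show g * h = e (e.symm g) * e (e.symm h)
    rw [Equiv.apply_symm_apply, Equiv.apply_symm_apply]
  · apply e.injective
    rw [Equiv.apply_symm_apply]
    show u = u ^ (1 : ZMod 4).val * (((Additive.toMul (0 : Additive K) : K)) : A)
    rw [show (1 : ZMod 4).val = 1 by rfl, pow_one, toMul_zero, Subgroup.coe_one, mul_one]
  · apply e.injective
    rw [Equiv.apply_symm_apply]
    show (k : A) = u ^ (0 : ZMod 4).val * (((Additive.toMul (Additive.ofMul k) : K)) : A)
    rw [ZMod.val_zero, pow_zero, one_mul, toMul_ofMul]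
  · apply e.injective
    rw [Equiv.apply_symm_apply]
    show u ^ 2 = u ^ (2 : ZMod 4).val * (((Additive.toMul (0 : Additive K) : K)) : A)
    rw [show (2 : ZMod 4).val = 2 by rfl, toMul_zero, Subgroup.coe_one, mul_one]

/-- The screw condition in multiplicative terms: `K` (additively) has an element of order divisible by `4` iff `K` does. [folklore] -/
theorem exists_four_dvd_addOrderOf_iff (K : Subgroup A) : (∃ t : Additive K, 4 ∣ addOrderOf t) ↔ ∃ k : K, 4 ∣ orderOf k := by
  constructor
  · rintro ⟨t, ht⟩
    exact ⟨Additive.toMul t, by rwa [← addOrderOf_ofMul_eq_orderOf, ofMul_toMul]⟩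
  · rintro ⟨k, hk⟩
    exact ⟨Additive.ofMul k, by rwa [addOrderOf_ofMul_eq_orderOf]⟩

end Summit.HodgeConjecture.CorCM.FaceQuarticTwist
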